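import Literature.Geometry.Kaehler.ComplexTorusIsotropicDescent
import Literature.Geometry.Kaehler.ComplexTorusComplementaryTypes
import Literature.Geometry.Kaehler.ComplexTorusPoincareReducibility
import Literature.Geometry.Kaehler.ComplexTorusDualProduct
import HarnessLib

/-!
# Debarre's construction `(Y × Z)/graph(p)` is principally polarised (Iribar López 2024, Lemma 10, first part)

Layer `Literature/Geometry/Kaehler`, namespace `Literature.Geometry.Kaehler.ComplexTorus`; lane `lit-hodgefound`
(Track 2 foundations library, Layer A4, row A4-76, seat `lit-hodgefound-skel-4`, FILE A of the row).  Sequel of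
`ComplexTorusIsotropicDescent.lean` (Lange 2023, Prop. 2.7.2 / Cor. 2.7.3 (a): descent of `L` along an isogeny with
isotropic kernel, `isPrincipalPolarization_quotientBy_iff`, `sq_natCard_eq_iff_maximal_isotropic`),
`ComplexTorusKHWeilPairing.lean` (the Weil pairing `ε^L = weilPairing Φ η` on `K(L) = kerPhiH Φ G`),
`ComplexTorusQuotientFiniteSubgroup.lean` (the quotient `X/Γ = quotientByPeriod Φ Γ`, `Ker (X → X/Γ) = Γ`),
`ComplexTorusProduct.lean` / `ComplexTorusPoincareReducibility.lean` (`prodPeriod`, `prodForm`, `latticeGram_prod`,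
`fstSubspace`, `sndSubspace`) and `ComplexTorusComplementaryTypes.lean` (`subtorus Φ V`).

Sources followed.  A. Iribar López, *Noether–Lefschetz cycles on the moduli space of abelian varieties*, Forum
Math. Pi (2026), held text `paper:arxiv-2411.09910`, §2.1 p. 7 L5 and §2.2 p. 7 L118–L137, VERBATIM:

> "If `θ : X → X^∨` is a polarization on an abelian variety, `K(θ)` carries a symplectic form, and given a
> Lagrangian subgroup `H` of `K(θ)`, there is a unique principal polarization `θ_H` on `X/H`."
> "Conversely, given polarized abelian varieties `(X, θ_X) ∈ 𝒜_{u,δ}`, `(Y, θ_Y) ∈ 𝒜_{g−u,δ̃}` we can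
> construct principally polarized abelian varieties `X` containing `Y` and `Z` as complementary subvarieties with
> the prescribed polarization. This construction is due to Debarre [D88], and is also explained with detail in
> [A16]. […] **Lemma 10.** With notation as above, for any antisymplectic isomorphism `p : K(θ_Y) → K(θ_Z)`,
> the abelian variety `(Y × Z)/graph(p)` has a canonical principal polarization `θ_p` and contains `(Y, θ_Y)`,
> `(Z, θ_Z)` as complementary subvarieties. Moreover, the isomorphism type of `((Y × Z)/graph(p), θ_p)` does not
> depend on `p`, and all principally polarized abelian varieties having `Y` and `Z` as complementary
> subvarieties arise this way."

R. Auffarth, *On a numerical characterization of non-simple principally polarized abelian varieties*, Math. Z.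
282 (2016), held text `paper:arxiv-1507.08618`, §3 p. 9 L45–L49 and proof of Lemma 3.7, p. 10 L40, VERBATIM:

> "Debarre presents the morphism `Φ_{u,n−u}(D) : 𝒜_u(D) × 𝒜_{n−u}(D̃) → 𝒜^D_{u,n−u}` where
> `((X, L_X, f), (Y, L_Y, g)) ↦ (X × Y)/Γ_{g⁻¹εf}`, and `Γ_{g⁻¹εf}` denotes the graph of `g⁻¹εf`. By descent theory
> for abelian varieties, `(X × Y)/Γ_{g⁻¹εf}` has a unique principal polarization `L` (that is, a line bundle
> unique up to translation) such that its pullback to `X × Y` is `L_X ⊠ L_Y`."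
> "It is not hard to see that if `D = (d₁, …, d_u)`, then `|H_η| = |H| = (d₁⋯d_u)²`. Moreover,
> `H ∩ {0} × Y = H ∩ X × {0} = {(0,0)}`, and so `H` is a maximal isotropic subgroup for `L_X ⊠ L_Y`. By descent
> theory for abelian varieties, `L_X ⊠ L_Y` descends to a principal polarization."

(The original construction is O. Debarre, Duke Math. J. 57 (1988) — not held; cited through the two sources
above.  "Descent theory" is Lange 2023 §2.7.1 Prop. 2.7.2 / Cor. 2.7.3 (a), the tree's
`ComplexTorusIsotropicDescent`.)

## Lean rendering (the tree's analytic carrier, as everywhere in the lane)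

`Y = E₁/Φ₁(ℤ^{ι₁})`, `Z = E₂/Φ₂(ℤ^{ι₂})` are `ComplexTorus Φ₁`, `ComplexTorus Φ₂`; their product is
`ComplexTorus (prodPeriod Φ₁ Φ₂)` (a point `t` has components `prodHomeomorph Φ₁ Φ₂ t = (t|ι₁, t|ι₂)`), polarised
by `c₁(L₁ ⊠ L₂) = prodForm ω₁ ω₂ = p₁^*ω₁ + p₂^*ω₂` with block Gram matrix `fromBlocks G₁ 0 0 G₂`
(`fromBlocks_map_eq_latticeGram_prod` of `ComplexTorusDualProduct`).  `K(θ_Y) = kerPhiH Φ₁ G₁`, `K(θ_Z) = kerPhiH Φ₂ G₂`, the "symplectic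
form" on `K(θ)` is the Weil pairing `ε^L = weilPairing Φ ω` (Lange (2.13)); "antisymplectic" is
`IsAntisymplectic ω₁ ω₂ p : ε^{L₂}(p s, p t) = ε^{L₁}(s, t)⁻¹`; `graph(p)` is `graphSubgroup K₁ K₂ p` (the range of
`s ↦ (s, p s)`, `graphInclusion`); the quotient `(Y × Z)/graph(p)` is `quotientByPeriod (prodPeriod Φ₁ Φ₂) (graphSubgroup …)`,
the torus `(E₁ × E₂)/π⁻¹(graph(p))` on the SAME covering space, with projection
`π = mapMatrix _ _ (quotientMatrix …)` of kernel exactly `graph(p)` (`ker_mapMatrixHom_quotientBy`); "Lagrangian" =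
maximal isotropic (`graph(p)^⊥ ⊆ graph(p)`, `forall_isotropic_imp_eq_iff`).  Statements about the quotient carry
the instance argument `[Finite (graphSubgroup …)]`, supplied by `IsRiemannForm.finite_graphSubgroup` (no
`instance` is declared).

## Main statements (all proved; 3 small definitions with bodies — `graphInclusion`, `graphSubgroup`,
`IsAntisymplectic` —, no named fact, net debt 0)

* §1 products: `mem_kerPhiH_prodPeriod_iff` (**`K(L₁ ⊠ L₂) = K(L₁) × K(L₂)`**), `natCard_kerPhiH_prodPeriod`,
  **`weilPairing_prodPeriod_prodForm`** (`ε^{L₁ ⊠ L₂} = ε^{L₁} · ε^{L₂}` componentwise),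
  `mem_subtorus_fstSubspace_iff` / `mem_subtorus_sndSubspace_iff` (`Y × 0`, `0 × Z` by components);
* §2 the graph: `graphInclusion`, `graphSubgroup`, `mem_graphSubgroup_iff(_exists)`, `natCard_graphSubgroup` (`= #K₁`),
  `finite_graphSubgroup`, `graphSubgroup_inf_subtorus_fstSubspace` / `…_sndSubspace` (**`graph(p)` meets the
  factors trivially**), `graphSubgroup_le_kerPhiH`;
* §3 `IsAntisymplectic`, `IsAntisymplectic.neg` / `.symm` / `.injective` (Lemma 2.7.1 (ii)),
  `weilPairing_graphInclusion`, **`forall_weilPairing_graphSubgroup_eq_one_iff`** (`graph(p)` is isotropic for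
  `ε^{L₁ ⊠ L₂}` iff `p` is antisymplectic);
* §4 for Riemann forms `ω₁`, `ω₂` and an antisymplectic BIJECTION `p : K(L₁) → K(L₂)`: `natCard_graphSubgroup_sq`
  (`(#graph)² = #K(L₁ ⊠ L₂)`), **`graphSubgroup_maximal_isotropic`** (and the `U`-form `…'`),
  `isNSForm_/isRiemannForm_quotientBy_graphSubgroup`, **`isPrincipalPolarization_quotientBy_graphSubgroup`**
  (LEMMA 10, first assertion: `(Y × Z)/graph(p)` is principally polarised by the descended `L₁ ⊠ L₂`),
  `isAbelianVariety_quotientBy_graphSubgroup`,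
  **`exists_isPrincipalPolarization_isTrivialOn_pullback_quotientBy_graphSubgroup`** ("canonical": `L₁ ⊠ L₂ = π^*M`,
  `M` principal — Cor. 2.7.3 (a) assembled), `natCard_ker_mapMatrixHom_quotientBy_graphSubgroup` (`deg π = #K₁`),
  `eq_zero_of_mem_subtorus_fst/sndSubspace_of_mapMatrix_quotientBy_eq_zero` (`π` is injective on `Y × 0` and on
  `0 × Z`);
* §5 validation (`u = 0`): `IsPrincipalPolarization.graphSubgroup_eq_bot`, `IsPrincipalPolarization.of_bijective_kerPhiH`.

NOT here (FILE B / FILE C of the row): the images of `Y × 0`, `0 × Z` as complementary abelian subvarieties of the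
quotient with induced types `δ`, `δ̃`; the Siegel-space reading (`NL_{g,δ}`); "does not depend on `p`"; "all
principally polarized abelian varieties … arise this way"; existence of antisymplectic isomorphisms for given types.

## References

* [IribarLopez2024NoetherLefschetzCycles] A. Iribar López, *Noether–Lefschetz cycles on the moduli space of abelian
  varieties*, Forum Math. Pi (2026), arXiv:2411.09910, §2.1–§2.2, Lemma 10 (p. 7), Def. 4 (p. 8).
* [Auffarth2016NonSimplePPAV] R. Auffarth, *On a numerical characterization of non-simple principally polarized
  abelian varieties*, Math. Z. 282 (2016) 731–746, arXiv:1507.08618, §3 (pp. 9–10), Thm. 3.5, Lemma 3.7.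
* [Debarre1988ThetaSingulierCodim3] O. Debarre, *Sur les variétés abéliennes dont le diviseur thêta est singulier
  en codimension 3*, Duke Math. J. 57 (1988) 221–273 (the original construction; via the two sources above).
* [Lange2023AbelianVarietiesComplex] H. Lange, *Abelian Varieties over the Complex Numbers* (2023), §1.1.2
  (quotients `X/Γ`, Prop. 1.1.13), §1.4.2 Prop. 1.4.7, §2.4.4 Cor. 2.4.24, §2.7.1 (2.13), Lemma 2.7.1,
  Prop. 2.7.2, Cor. 2.7.3 (a).
* [LangeBirkenhake1992] H. Lange, Ch. Birkenhake, *Complex Abelian Varieties* (1992), §5.3 (products), §6.3.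
-/

noncomputable section

open Complex Module Function Matrix
open scoped Manifold

namespace Literature.Geometry.Kaehler

namespace ComplexTorus

variable {ι₁ ι₂ : Type*} [Fintype ι₁] [Fintype ι₂] {E₁ E₂ : Type*} [NormedAddCommGroup E₁]
  [NormedSpace ℂ E₁] [NormedAddCommGroup E₂] [NormedSpace ℂ E₂]
  (Φ₁ : (ι₁ → ℝ) ≃L[ℝ] E₁) (Φ₂ : (ι₂ → ℝ) ≃L[ℝ] E₂)
  (ω₁ : E₁ [⋀^Fin 2]→L[ℝ] ℝ) (ω₂ : E₂ [⋀^Fin 2]→L[ℝ] ℝ)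

/-! ### §1 Points of `Y × Z`: components, `K(L₁ ⊠ L₂) = K(L₁) × K(L₂)`, the Weil pairing of `L₁ ⊠ L₂` -/

section Product

/-- The canonical lift of a point of `Y × Z` restricts to the canonical lifts of its components
(first factor). [cite: LangeBirkenhake1992, §5.3 (products)] -/
theorem lift_prodPeriod_inl (t : ComplexTorus (prodPeriod Φ₁ Φ₂)) :
    (fun i ↦ lift (prodPeriod Φ₁ Φ₂) t (Sum.inl i)) = lift Φ₁ (prodHomeomorph Φ₁ Φ₂ t).1 := rfl

/-- The canonical lift of a point of `Y × Z` restricts to the canonical lifts of its components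
(second factor). [cite: LangeBirkenhake1992, §5.3 (products)] -/
theorem lift_prodPeriod_inr (t : ComplexTorus (prodPeriod Φ₁ Φ₂)) :
    (fun j ↦ lift (prodPeriod Φ₁ Φ₂) t (Sum.inr j)) = lift Φ₂ (prodHomeomorph Φ₁ Φ₂ t).2 := rfl

/-- A point of `Y × Z` vanishes iff both components vanish. [cite: LangeBirkenhake1992, §5.3 (products)] -/
theorem eq_zero_iff_prodHomeomorph (t : ComplexTorus (prodPeriod Φ₁ Φ₂)) :
    t = 0 ↔ (prodHomeomorph Φ₁ Φ₂ t).1 = 0 ∧ (prodHomeomorph Φ₁ Φ₂ t).2 = 0 := by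
  constructor
  · rintro rfl
    exact ⟨rfl, rfl⟩
  · rintro ⟨h₁, h₂⟩
    funext k
    rcases k with i | j
    · exact congrFun h₁ i
    · exact congrFun h₂ j

/-- `prodHomeomorph` is injective (two points with the same components are equal).
[cite: LangeBirkenhake1992, §5.3 (products)] -/
theorem prodHomeomorph_injective : Injective (prodHomeomorph Φ₁ Φ₂) :=
  (prodHomeomorph Φ₁ Φ₂).injective

/-- The point of `Y × Z` with components `(s₁, s₂)`: `prodHomeomorph⁻¹(s₁, s₂) = (s₁, s₂)` as a function on
`ι₁ ⊔ ι₂`. [cite: LangeBirkenhake1992, §5.3 (products)] -/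
theorem prodHomeomorph_symm_apply (s : ComplexTorus Φ₁ × ComplexTorus Φ₂) :
    (prodHomeomorph Φ₁ Φ₂).symm s = (Sum.elim (s.1 : ι₁ → AddCircle (1 : ℝ)) (s.2 : ι₂ → AddCircle (1 : ℝ)) :
      ComplexTorus (prodPeriod Φ₁ Φ₂)) := by
  apply (prodHomeomorph Φ₁ Φ₂).injective
  rw [Homeomorph.apply_symm_apply, prodHomeomorph_apply]
  rfl

variable [DecidableEq ι₁] [DecidableEq ι₂]

omit [Fintype ι₁] [Fintype ι₂] [DecidableEq ι₁] [DecidableEq ι₂] in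
/-- An integer-valued real vector on `ι₁ ⊔ ι₂` is integer-valued on both halves. [folklore] -/
private theorem sumElim_eq_intVec_iff {x₁ : ι₁ → ℝ} {x₂ : ι₂ → ℝ} :
    (∃ n : ι₁ ⊕ ι₂ → ℤ, Sum.elim x₁ x₂ = intVec n) ↔
      (∃ n₁ : ι₁ → ℤ, x₁ = intVec n₁) ∧ ∃ n₂ : ι₂ → ℤ, x₂ = intVec n₂ := by
  constructor
  · rintro ⟨n, hn⟩
    refine ⟨⟨fun i ↦ n (Sum.inl i), funext fun i ↦ ?_⟩, ⟨fun j ↦ n (Sum.inr j), funext fun j ↦ ?_⟩⟩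
    · have := congrFun hn (Sum.inl i)
      simpa [intVec] using this
    · have := congrFun hn (Sum.inr j)
      simpa [intVec] using this
  · rintro ⟨⟨n₁, h₁⟩, ⟨n₂, h₂⟩⟩
    refine ⟨Sum.elim n₁ n₂, funext fun k ↦ ?_⟩
    rcases k with i | j
    · have := congrFun h₁ i
      simpa [intVec] using this
    · have := congrFun h₂ j
      simpa [intVec] using this

/-- **`K(L₁ ⊠ L₂) = K(L₁) × K(L₂)`, on representatives**: `π(x₁, x₂) ∈ K(L₁ ⊠ L₂) ↔ π₁ x₁ ∈ K(L₁) ∧ π₂ x₂ ∈ K(L₂)`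
for the block Gram matrix `(G₁ 0; 0 G₂)` of `p₁^*ω₁ + p₂^*ω₂` (the homomorphism `φ_{L₁ ⊠ L₂} = φ_{L₁} × φ_{L₂}` is
"given by the matrix `(φ_{ι_Y^*L} 0; 0 φ_{ι_Z^*L})`", so its kernel is the product of the kernels).
[cite: Lange2023AbelianVarietiesComplex, §2.4.4 Cor. 2.4.24] -/
theorem proj_mem_kerPhiH_prodPeriod_iff (G₁ : Matrix ι₁ ι₁ ℤ) (G₂ : Matrix ι₂ ι₂ ℤ) (x : ι₁ ⊕ ι₂ → ℝ) :
    proj (prodPeriod Φ₁ Φ₂) x ∈ kerPhiH (prodPeriod Φ₁ Φ₂) (Matrix.fromBlocks G₁ 0 0 G₂) ↔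
      proj Φ₁ (fun i ↦ x (Sum.inl i)) ∈ kerPhiH Φ₁ G₁ ∧ proj Φ₂ (fun j ↦ x (Sum.inr j)) ∈ kerPhiH Φ₂ G₂ := by
  rw [kerPhiH, kerPhiH, kerPhiH, proj_mem_ker_mapMatrixHom_iff, proj_mem_ker_mapMatrixHom_iff,
    proj_mem_ker_mapMatrixHom_iff, Matrix.fromBlocks_transpose, Matrix.fromBlocks_map, Matrix.fromBlocks_mulVec]
  simp only [Matrix.transpose_zero, Matrix.map_zero _ Int.cast_zero, Matrix.zero_mulVec, add_zero, zero_add,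
    Function.comp_def]
  exact sumElim_eq_intVec_iff

/-- **`K(L₁ ⊠ L₂) = K(L₁) × K(L₂)`**: a point of `Y × Z` lies in `K(L₁ ⊠ L₂)` iff its components lie in
`K(L₁)` and `K(L₂)`. [cite: Lange2023AbelianVarietiesComplex, §2.4.4 Cor. 2.4.24] -/
theorem mem_kerPhiH_prodPeriod_iff (G₁ : Matrix ι₁ ι₁ ℤ) (G₂ : Matrix ι₂ ι₂ ℤ)
    (t : ComplexTorus (prodPeriod Φ₁ Φ₂)) :
    t ∈ kerPhiH (prodPeriod Φ₁ Φ₂) (Matrix.fromBlocks G₁ 0 0 G₂) ↔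
      (prodHomeomorph Φ₁ Φ₂ t).1 ∈ kerPhiH Φ₁ G₁ ∧ (prodHomeomorph Φ₁ Φ₂ t).2 ∈ kerPhiH Φ₂ G₂ := by
  rw [← proj_lift (prodPeriod Φ₁ Φ₂) t, prodHomeomorph_proj]
  exact proj_mem_kerPhiH_prodPeriod_iff Φ₁ Φ₂ G₁ G₂ _

/-- **`#K(L₁ ⊠ L₂) = #K(L₁) · #K(L₂)`** (`det (G₁ 0; 0 G₂) = det G₁ · det G₂`, Prop. 1.4.7).
[cite: Lange2023AbelianVarietiesComplex, §2.4.4 Cor. 2.4.24 and §1.4.2 Prop. 1.4.7] -/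
theorem natCard_kerPhiH_prodPeriod (G₁ : Matrix ι₁ ι₁ ℤ) (G₂ : Matrix ι₂ ι₂ ℤ) :
    Nat.card (kerPhiH (prodPeriod Φ₁ Φ₂) (Matrix.fromBlocks G₁ 0 0 G₂)) =
      Nat.card (kerPhiH Φ₁ G₁) * Nat.card (kerPhiH Φ₂ G₂) := by
  rw [natCard_kerPhiH, natCard_kerPhiH, natCard_kerPhiH, Matrix.det_fromBlocks_zero₂₁, Int.natAbs_mul]

omit [DecidableEq ι₁] [DecidableEq ι₂] in
/-- **The Weil pairing of `L₁ ⊠ L₂` is the product of the Weil pairings of the factors**: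
`ε^{L₁ ⊠ L₂}((s₁, s₂), (t₁, t₂)) = ε^{L₁}(s₁, t₁) · ε^{L₂}(s₂, t₂)` — on the tree's canonical representatives
this holds at every pair of points (`c₁(L₁ ⊠ L₂) = p₁^*ω₁ + p₂^*ω₂` and `e(−2πi(a + b)) = e(−2πi a) e(−2πi b)`).
[cite: Lange2023AbelianVarietiesComplex, §2.7.1 (2.13) with §2.4.4 Cor. 2.4.24] [cite: Auffarth2016NonSimplePPAV, §3 (the graph of an anti-symplectic map is isotropic for `L_X ⊠ L_Y`)] -/
theorem weilPairing_prodPeriod_prodForm (s t : ComplexTorus (prodPeriod Φ₁ Φ₂)) :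
    weilPairing (prodPeriod Φ₁ Φ₂) (prodForm ω₁ ω₂) s t =
      weilPairing Φ₁ ω₁ (prodHomeomorph Φ₁ Φ₂ s).1 (prodHomeomorph Φ₁ Φ₂ t).1 *
        weilPairing Φ₂ ω₂ (prodHomeomorph Φ₁ Φ₂ s).2 (prodHomeomorph Φ₁ Φ₂ t).2 := by
  rw [weilPairing_def, weilPairing_def, weilPairing_def, weilPairingFun_apply, weilPairingFun_apply,
    weilPairingFun_apply, prodPeriod_apply, prodPeriod_apply, prodForm_apply, ← Complex.exp_add]
  push_cast
  ring_nf
  rfl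

/-! #### The factors `Y × 0` and `0 × Z` as subgroups of `Y × Z` -/

omit [DecidableEq ι₁] [DecidableEq ι₂] in
/-- **`t ∈ Y × 0 ↔ t₂ = 0`** for the sub-torus `Y × 0 = π(fstSubspace)` of `Y × Z`.
[cite: Lange2023AbelianVarietiesComplex, §2.4.4 Cor. 2.4.24 (p. 123)] -/
theorem mem_subtorus_fstSubspace_iff (t : ComplexTorus (prodPeriod Φ₁ Φ₂)) :
    t ∈ subtorus (prodPeriod Φ₁ Φ₂) (fstSubspace : Submodule ℝ (ι₁ ⊕ ι₂ → ℝ)) ↔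
      (prodHomeomorph Φ₁ Φ₂ t).2 = 0 := by
  rw [mem_subtorus_iff]
  constructor
  · rintro ⟨x, hx, rfl⟩
    rw [SetLike.mem_coe, mem_fstSubspace_iff] at hx
    have hx0 : (fun j ↦ x (Sum.inr j)) = intVec (0 : ι₂ → ℤ) := funext fun j ↦ by simp [hx j, intVec]
    rw [prodHomeomorph_proj, hx0, proj_intVec]
  · intro h
    refine ⟨Sum.elim (lift Φ₁ (prodHomeomorph Φ₁ Φ₂ t).1) 0, ?_, ?_⟩
    · rw [SetLike.mem_coe, mem_fstSubspace_iff]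
      intro j
      rfl
    · apply (prodHomeomorph Φ₁ Φ₂).injective
      rw [prodHomeomorph_proj, Prod.ext_iff]
      refine ⟨proj_lift Φ₁ _, ?_⟩
      rw [h]
      exact map_zero (projHom Φ₂)

omit [DecidableEq ι₁] [DecidableEq ι₂] in
/-- **`t ∈ 0 × Z ↔ t₁ = 0`** for the sub-torus `0 × Z = π(sndSubspace)` of `Y × Z`.
[cite: Lange2023AbelianVarietiesComplex, §2.4.4 Cor. 2.4.24 (p. 123)] -/
theorem mem_subtorus_sndSubspace_iff (t : ComplexTorus (prodPeriod Φ₁ Φ₂)) :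
    t ∈ subtorus (prodPeriod Φ₁ Φ₂) (sndSubspace : Submodule ℝ (ι₁ ⊕ ι₂ → ℝ)) ↔
      (prodHomeomorph Φ₁ Φ₂ t).1 = 0 := by
  rw [mem_subtorus_iff]
  constructor
  · rintro ⟨x, hx, rfl⟩
    rw [SetLike.mem_coe, mem_sndSubspace_iff] at hx
    have hx0 : (fun i ↦ x (Sum.inl i)) = intVec (0 : ι₁ → ℤ) := funext fun i ↦ by simp [hx i, intVec]
    rw [prodHomeomorph_proj, hx0, proj_intVec]
  · intro h
    refine ⟨Sum.elim 0 (lift Φ₂ (prodHomeomorph Φ₁ Φ₂ t).2), ?_, ?_⟩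
    · rw [SetLike.mem_coe, mem_sndSubspace_iff]
      intro i
      rfl
    · apply (prodHomeomorph Φ₁ Φ₂).injective
      rw [prodHomeomorph_proj, Prod.ext_iff]
      refine ⟨?_, proj_lift Φ₂ _⟩
      rw [h]
      exact map_zero (projHom Φ₁)

end Product

/-! ### §2 The graph `graph(p) ⊂ Y × Z` of a homomorphism `p : K₁ → K₂` of finite subgroups -/

section Graph

variable {Φ₁ Φ₂}
variable (K₁ : AddSubgroup (ComplexTorus Φ₁)) (K₂ : AddSubgroup (ComplexTorus Φ₂)) (p : K₁ →+ K₂)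

/-- `s ↦ (s, p s)`: the homomorphism `K₁ → Y × Z` whose image is the graph of `p : K₁ → K₂`
(`K₁ ⊆ Y`, `K₂ ⊆ Z` subgroups). [cite: IribarLopez2024NoetherLefschetzCycles, §2.2 Lemma 10 ("`(Y × Z)/graph(p)`")] [cite: Auffarth2016NonSimplePPAV, §3 ("`Γ_{g⁻¹εf}` denotes the graph of `g⁻¹εf`")] -/
def graphInclusion : K₁ →+ ComplexTorus (prodPeriod Φ₁ Φ₂) where
  toFun s := (prodHomeomorph Φ₁ Φ₂).symm ((s : ComplexTorus Φ₁), (p s : ComplexTorus Φ₂))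
  map_zero' := by
    apply (prodHomeomorph Φ₁ Φ₂).injective
    rw [Homeomorph.apply_symm_apply, map_zero]
    rfl
  map_add' s t := by
    apply (prodHomeomorph Φ₁ Φ₂).injective
    rw [prodHomeomorph_add, Homeomorph.apply_symm_apply, Homeomorph.apply_symm_apply,
      Homeomorph.apply_symm_apply, map_add]
    rfl

/-- The components of `graphInclusion p s` are `(s, p s)`. [cite: IribarLopez2024NoetherLefschetzCycles, §2.2 Lemma 10] -/
@[simp] theorem prodHomeomorph_graphInclusion (s : K₁) :
    prodHomeomorph Φ₁ Φ₂ (graphInclusion K₁ K₂ p s) = ((s : ComplexTorus Φ₁), (p s : ComplexTorus Φ₂)) :=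
  (prodHomeomorph Φ₁ Φ₂).apply_symm_apply _

/-- `graphInclusion p` is injective (its first component is the inclusion `K₁ ⊆ Y`).
[cite: IribarLopez2024NoetherLefschetzCycles, §2.2 Lemma 10] -/
theorem graphInclusion_injective : Injective (graphInclusion K₁ K₂ p) := fun s t h ↦ by
  have h1 := congrArg (fun u ↦ (prodHomeomorph Φ₁ Φ₂ u).1) h
  simp only [prodHomeomorph_graphInclusion] at h1
  exact Subtype.ext h1

/-- **`graph(p) ⊂ Y × Z`**: the subgroup `{(s, p s) ∣ s ∈ K₁}` of the product torus, for a homomorphism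
`p : K₁ → K₂` between subgroups `K₁ ⊆ Y`, `K₂ ⊆ Z` (Mathlib's `AddMonoidHom.graph`, transported to the tree's
product torus `ComplexTorus (prodPeriod Φ₁ Φ₂)`). [cite: IribarLopez2024NoetherLefschetzCycles, §2.2 Lemma 10 ("`(Y × Z)/graph(p)`")] [cite: Auffarth2016NonSimplePPAV, §3 ("`Γ_{g⁻¹εf}` denotes the graph")] -/
def graphSubgroup : AddSubgroup (ComplexTorus (prodPeriod Φ₁ Φ₂)) := (graphInclusion K₁ K₂ p).range

/-- `t ∈ graph(p) ↔ t = (s, p s)` for some `s ∈ K₁`. [cite: IribarLopez2024NoetherLefschetzCycles, §2.2 Lemma 10] -/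
theorem mem_graphSubgroup_iff {t : ComplexTorus (prodPeriod Φ₁ Φ₂)} :
    t ∈ graphSubgroup K₁ K₂ p ↔ ∃ s : K₁, graphInclusion K₁ K₂ p s = t := AddMonoidHom.mem_range

/-- `(s, p s) ∈ graph(p)`. [cite: IribarLopez2024NoetherLefschetzCycles, §2.2 Lemma 10] -/
theorem graphInclusion_mem_graphSubgroup (s : K₁) : graphInclusion K₁ K₂ p s ∈ graphSubgroup K₁ K₂ p := ⟨s, rfl⟩

/-- **`t ∈ graph(p) ↔ t₁ ∈ K₁` and `t₂ = p(t₁)`** (membership by components).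
[cite: IribarLopez2024NoetherLefschetzCycles, §2.2 Lemma 10] -/
theorem mem_graphSubgroup_iff_exists {t : ComplexTorus (prodPeriod Φ₁ Φ₂)} :
    t ∈ graphSubgroup K₁ K₂ p ↔ ∃ h : (prodHomeomorph Φ₁ Φ₂ t).1 ∈ K₁,
      (prodHomeomorph Φ₁ Φ₂ t).2 = (p ⟨(prodHomeomorph Φ₁ Φ₂ t).1, h⟩ : ComplexTorus Φ₂) := by
  rw [mem_graphSubgroup_iff]
  constructor
  · rintro ⟨s, rfl⟩
    rw [prodHomeomorph_graphInclusion]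
    exact ⟨s.2, rfl⟩
  · rintro ⟨h, h2⟩
    refine ⟨⟨(prodHomeomorph Φ₁ Φ₂ t).1, h⟩, (prodHomeomorph Φ₁ Φ₂).injective ?_⟩
    rw [prodHomeomorph_graphInclusion, Prod.ext_iff]
    exact ⟨rfl, h2.symm⟩

/-- The first component of a point of `graph(p)` lies in `K₁`. [cite: IribarLopez2024NoetherLefschetzCycles, §2.2 Lemma 10] -/
theorem fst_mem_of_mem_graphSubgroup {t : ComplexTorus (prodPeriod Φ₁ Φ₂)} (ht : t ∈ graphSubgroup K₁ K₂ p) :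
    (prodHomeomorph Φ₁ Φ₂ t).1 ∈ K₁ := by
  obtain ⟨h, -⟩ := (mem_graphSubgroup_iff_exists K₁ K₂ p).1 ht
  exact h

/-- The second component of a point of `graph(p)` lies in `K₂`. [cite: IribarLopez2024NoetherLefschetzCycles, §2.2 Lemma 10] -/
theorem snd_mem_of_mem_graphSubgroup {t : ComplexTorus (prodPeriod Φ₁ Φ₂)} (ht : t ∈ graphSubgroup K₁ K₂ p) :
    (prodHomeomorph Φ₁ Φ₂ t).2 ∈ K₂ := by
  obtain ⟨s, rfl⟩ := (mem_graphSubgroup_iff K₁ K₂ p).1 ht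
  rw [prodHomeomorph_graphInclusion]
  exact (p s).2

/-- **`#graph(p) = #K₁`.** [cite: Auffarth2016NonSimplePPAV, §3, proof of Lemma 3.7 ("`|H| = (d₁⋯d_u)²`")] -/
theorem natCard_graphSubgroup : Nat.card (graphSubgroup K₁ K₂ p) = Nat.card K₁ :=
  (Nat.card_congr (Equiv.ofInjective _ (graphInclusion_injective K₁ K₂ p)).symm :
    Nat.card (Set.range (graphInclusion K₁ K₂ p)) = Nat.card K₁)

/-- `graph(p)` is finite when `K₁` is. [cite: Auffarth2016NonSimplePPAV, §3, proof of Lemma 3.7 ("a finite subgroup `H ≤ X × Y`")] -/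
theorem finite_graphSubgroup [Finite K₁] : Finite (graphSubgroup K₁ K₂ p) :=
  (Finite.of_injective _ (Equiv.ofInjective _ (graphInclusion_injective K₁ K₂ p)).symm.injective :
    Finite (Set.range (graphInclusion K₁ K₂ p)))

/-- **`graph(p) ∩ (0 × Z) = 0`**: a point of the graph with trivial first component is trivial.
[cite: Auffarth2016NonSimplePPAV, §3, proof of Lemma 3.7 ("`H ∩ {0} × Y = H ∩ X × {0} = {(0,0)}`")] -/
theorem eq_zero_of_mem_graphSubgroup_of_fst_eq_zero {t : ComplexTorus (prodPeriod Φ₁ Φ₂)}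
    (ht : t ∈ graphSubgroup K₁ K₂ p) (h0 : (prodHomeomorph Φ₁ Φ₂ t).1 = 0) : t = 0 := by
  obtain ⟨s, rfl⟩ := (mem_graphSubgroup_iff K₁ K₂ p).1 ht
  rw [prodHomeomorph_graphInclusion] at h0
  have hs : s = 0 := Subtype.ext h0
  rw [hs, map_zero]

/-- **`graph(p) ∩ (Y × 0) = 0` when `p` is injective**: a point of the graph with trivial second component
is trivial. [cite: Auffarth2016NonSimplePPAV, §3, proof of Lemma 3.7 ("`H ∩ {0} × Y = H ∩ X × {0} = {(0,0)}`")] -/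
theorem eq_zero_of_mem_graphSubgroup_of_snd_eq_zero (hp : Injective p) {t : ComplexTorus (prodPeriod Φ₁ Φ₂)}
    (ht : t ∈ graphSubgroup K₁ K₂ p) (h0 : (prodHomeomorph Φ₁ Φ₂ t).2 = 0) : t = 0 := by
  obtain ⟨s, rfl⟩ := (mem_graphSubgroup_iff K₁ K₂ p).1 ht
  rw [prodHomeomorph_graphInclusion] at h0
  have hs : s = 0 := hp (Subtype.ext (by rw [map_zero]; exact h0))
  rw [hs, map_zero]

/-- **`graph(p) ∩ (0 × Z) = 0`** as subgroups of `Y × Z`.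
[cite: Auffarth2016NonSimplePPAV, §3, proof of Lemma 3.7 ("`H ∩ {0} × Y = {(0,0)}`")] -/
theorem graphSubgroup_inf_subtorus_sndSubspace :
    graphSubgroup K₁ K₂ p ⊓ subtorus (prodPeriod Φ₁ Φ₂) (sndSubspace : Submodule ℝ (ι₁ ⊕ ι₂ → ℝ)) = ⊥ := by
  rw [eq_bot_iff]
  rintro t ⟨ht, ht'⟩
  rw [AddSubgroup.mem_bot]
  exact eq_zero_of_mem_graphSubgroup_of_fst_eq_zero K₁ K₂ p ht
    ((mem_subtorus_sndSubspace_iff Φ₁ Φ₂ t).1 ht')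

/-- **`graph(p) ∩ (Y × 0) = 0`** as subgroups of `Y × Z`, for `p` injective.
[cite: Auffarth2016NonSimplePPAV, §3, proof of Lemma 3.7 ("`H ∩ X × {0} = {(0,0)}`")] -/
theorem graphSubgroup_inf_subtorus_fstSubspace (hp : Injective p) :
    graphSubgroup K₁ K₂ p ⊓ subtorus (prodPeriod Φ₁ Φ₂) (fstSubspace : Submodule ℝ (ι₁ ⊕ ι₂ → ℝ)) = ⊥ := by
  rw [eq_bot_iff]
  rintro t ⟨ht, ht'⟩
  rw [AddSubgroup.mem_bot]
  exact eq_zero_of_mem_graphSubgroup_of_snd_eq_zero K₁ K₂ p hp ht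
    ((mem_subtorus_fstSubspace_iff Φ₁ Φ₂ t).1 ht')

/-- The trivial case `K₁ = 0`: the graph is trivial. [cite: IribarLopez2024NoetherLefschetzCycles, §2.2 Lemma 10 (the case `u = 0`)] -/
theorem graphSubgroup_eq_bot_of_eq_bot (h : K₁ = ⊥) : graphSubgroup K₁ K₂ p = ⊥ := by
  rw [eq_bot_iff]
  rintro t ht
  obtain ⟨s, rfl⟩ := (mem_graphSubgroup_iff K₁ K₂ p).1 ht
  have hs : s = 0 := Subtype.ext ((AddSubgroup.eq_bot_iff_forall _).1 h _ s.2)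
  rw [AddSubgroup.mem_bot, hs, map_zero]

variable [DecidableEq ι₁] [DecidableEq ι₂]

/-- **`graph(p) ⊆ K(L₁ ⊠ L₂)`** when `K₁ ⊆ K(L₁)` and `K₂ ⊆ K(L₂)`.
[cite: Auffarth2016NonSimplePPAV, §3, proof of Lemma 3.7 ("`H` is a maximal isotropic subgroup for `L_X ⊠ L_Y`")] -/
theorem graphSubgroup_le_kerPhiH {G₁ : Matrix ι₁ ι₁ ℤ} {G₂ : Matrix ι₂ ι₂ ℤ} (hK₁ : K₁ ≤ kerPhiH Φ₁ G₁)
    (hK₂ : K₂ ≤ kerPhiH Φ₂ G₂) :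
    graphSubgroup K₁ K₂ p ≤ kerPhiH (prodPeriod Φ₁ Φ₂) (Matrix.fromBlocks G₁ 0 0 G₂) := by
  rintro t ⟨s, rfl⟩
  rw [mem_kerPhiH_prodPeriod_iff, prodHomeomorph_graphInclusion]
  exact ⟨hK₁ s.2, hK₂ (p s).2⟩

end Graph

/-! ### §3 Antisymplectic maps: `graph(p)` is isotropic for `ε^{L₁ ⊠ L₂}` iff `p` is antisymplectic -/

section Antisymplectic

variable {Φ₁ Φ₂}
variable {K₁ : AddSubgroup (ComplexTorus Φ₁)} {K₂ : AddSubgroup (ComplexTorus Φ₂)}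

/-- **An antisymplectic homomorphism `p : K₁ → K₂`** (`K₁ ⊆ Y`, `K₂ ⊆ Z`) for the Weil pairings `ε^{L₁}` of
`(Y, ω₁)` and `ε^{L₂}` of `(Z, ω₂)`: `ε^{L₂}(p s, p t) = ε^{L₁}(s, t)⁻¹` for all `s, t ∈ K₁` ("`K(θ)` carries a
symplectic form"; "antisymplectic isomorphism `p : K(θ_Y) → K(θ_Z)`").
[cite: IribarLopez2024NoetherLefschetzCycles, §2.1 (p. 7) and §2.2 Lemma 10] [cite: Auffarth2016NonSimplePPAV, §3 ("the anti-symplectic involution `ε` of `K(D) = K(D̃)`")] -/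
def IsAntisymplectic (p : K₁ →+ K₂) : Prop :=
  ∀ s t : K₁, weilPairing Φ₂ ω₂ (p s : ComplexTorus Φ₂) (p t) = (weilPairing Φ₁ ω₁ (s : ComplexTorus Φ₁) t)⁻¹

variable {ω₁ ω₂} {p : K₁ →+ K₂}

omit [Fintype ι₁] [Fintype ι₂] in
/-- Unfolding of `IsAntisymplectic`. [cite: IribarLopez2024NoetherLefschetzCycles, §2.2 Lemma 10] -/
theorem isAntisymplectic_iff : IsAntisymplectic ω₁ ω₂ p ↔
    ∀ s t : K₁, weilPairing Φ₂ ω₂ (p s : ComplexTorus Φ₂) (p t) =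
      (weilPairing Φ₁ ω₁ (s : ComplexTorus Φ₁) t)⁻¹ := Iff.rfl

omit [Fintype ι₁] [Fintype ι₂] in
/-- `p` is antisymplectic iff `ε^{L₂}(p s, p t) = ε^{L₁}(t, s)` (`ε(v̄, w̄)⁻¹ = ε(w̄, v̄)`, Lemma 2.7.1 (i)).
[cite: Lange2023AbelianVarietiesComplex, §2.7.1 Lemma 2.7.1 (i)] [cite: IribarLopez2024NoetherLefschetzCycles, §2.2 Lemma 10] -/
theorem isAntisymplectic_iff_swap : IsAntisymplectic ω₁ ω₂ p ↔
    ∀ s t : K₁, weilPairing Φ₂ ω₂ (p s : ComplexTorus Φ₂) (p t) = weilPairing Φ₁ ω₁ (t : ComplexTorus Φ₁) s := by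
  refine forall_congr' fun s ↦ forall_congr' fun t ↦ ?_
  rw [← weilPairing_swap Φ₁ ω₁ (t : ComplexTorus Φ₁) s]

omit [Fintype ι₁] [Fintype ι₂] in
/-- For an antisymplectic `p`: `ε^{L₁}(s, t) · ε^{L₂}(p s, p t) = 1`.
[cite: Auffarth2016NonSimplePPAV, §3, proof of Lemma 3.7 ("`H` is … isotropic … for `L_X ⊠ L_Y`")] -/
theorem IsAntisymplectic.mul_eq_one (hp : IsAntisymplectic ω₁ ω₂ p) (s t : K₁) :
    weilPairing Φ₁ ω₁ (s : ComplexTorus Φ₁) t * weilPairing Φ₂ ω₂ (p s : ComplexTorus Φ₂) (p t) = 1 := by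
  rw [hp s t, mul_inv_cancel₀ (weilPairing_ne_zero Φ₁ ω₁ _ _)]

omit [Fintype ι₁] in
/-- The composite of an antisymplectic map with the negation of `K₂` is antisymplectic
(`ε(−v̄, −w̄) = ε(v̄, w̄)` on `K(L₂)`). [cite: Lange2023AbelianVarietiesComplex, §2.7.1 Lemma 2.7.1 (i)] [cite: IribarLopez2024NoetherLefschetzCycles, §2.2 Lemma 10] -/
theorem IsAntisymplectic.neg [DecidableEq ι₂] {G₂ : Matrix ι₂ ι₂ ℤ}
    (hG₂ : G₂.map (Int.cast : ℤ → ℝ) = latticeGram Φ₂ ω₂) (hK₂ : K₂ ≤ kerPhiH Φ₂ G₂)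
    (hp : IsAntisymplectic ω₁ ω₂ p) : IsAntisymplectic ω₁ ω₂ (-p) := by
  intro s t
  rw [AddMonoidHom.neg_apply, AddMonoidHom.neg_apply, AddSubgroup.coe_neg, AddSubgroup.coe_neg,
    weilPairing_neg_left Φ₂ ω₂ hG₂ (hK₂ (p s).2) (neg_mem (hK₂ (p t).2)),
    weilPairing_neg_right Φ₂ ω₂ hG₂ (hK₂ (p s).2) (hK₂ (p t).2), inv_inv, hp s t]

omit [Fintype ι₁] [Fintype ι₂] in
/-- The inverse of an antisymplectic isomorphism is antisymplectic (for `ε^{L₂}`, `ε^{L₁}`).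
[cite: IribarLopez2024NoetherLefschetzCycles, §2.2 Lemma 10 and Def. 4 (`r : K(δ) → K(δ̃)`)] -/
theorem IsAntisymplectic.symm {e : K₁ ≃+ K₂} (he : IsAntisymplectic ω₁ ω₂ e.toAddMonoidHom) :
    IsAntisymplectic ω₂ ω₁ e.symm.toAddMonoidHom := by
  intro a b
  have h := he (e.symm a) (e.symm b)
  simp only [AddEquiv.toAddMonoidHom_eq_coe, AddMonoidHom.coe_coe, AddEquiv.apply_symm_apply] at h
  simp only [AddEquiv.toAddMonoidHom_eq_coe, AddMonoidHom.coe_coe]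
  rw [h, inv_inv]

variable (ω₁ ω₂ p) in
/-- **`ε^{L₁ ⊠ L₂}((s, p s), (t, p t)) = ε^{L₁}(s, t) · ε^{L₂}(p s, p t)`** on the graph of `p`.
[cite: Auffarth2016NonSimplePPAV, §3, proof of Lemma 3.7] [cite: Lange2023AbelianVarietiesComplex, §2.7.1 (2.13)] -/
theorem weilPairing_graphInclusion (s t : K₁) :
    weilPairing (prodPeriod Φ₁ Φ₂) (prodForm ω₁ ω₂) (graphInclusion K₁ K₂ p s) (graphInclusion K₁ K₂ p t) =
      weilPairing Φ₁ ω₁ (s : ComplexTorus Φ₁) t * weilPairing Φ₂ ω₂ (p s : ComplexTorus Φ₂) (p t) := by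
  rw [weilPairing_prodPeriod_prodForm, prodHomeomorph_graphInclusion, prodHomeomorph_graphInclusion]

/-- **`graph(p)` is isotropic for `ε^{L₁ ⊠ L₂}` iff `p` is antisymplectic.**
[cite: Auffarth2016NonSimplePPAV, §3, proof of Lemma 3.7 ("`H` is a maximal isotropic subgroup for `L_X ⊠ L_Y`")] [cite: IribarLopez2024NoetherLefschetzCycles, §2.2 Lemma 10] -/
theorem forall_weilPairing_graphSubgroup_eq_one_iff :
    (∀ s ∈ graphSubgroup K₁ K₂ p, ∀ t ∈ graphSubgroup K₁ K₂ p,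
        weilPairing (prodPeriod Φ₁ Φ₂) (prodForm ω₁ ω₂) s t = 1) ↔ IsAntisymplectic ω₁ ω₂ p := by
  constructor
  · intro h s t
    have h1 := h _ (graphInclusion_mem_graphSubgroup K₁ K₂ p s) _ (graphInclusion_mem_graphSubgroup K₁ K₂ p t)
    rw [weilPairing_graphInclusion] at h1
    exact eq_inv_of_mul_eq_one_right h1
  · rintro hp _ ⟨s, rfl⟩ _ ⟨t, rfl⟩
    rw [weilPairing_graphInclusion]
    exact hp.mul_eq_one s t

/-- **An antisymplectic map on `K₁ = K(L₁)` is injective** when `L₁` is non-degenerate: `p s = 0` gives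
`ε^{L₁}(s, K(L₁)) = 1`, hence `s = 0` (Lemma 2.7.1 (ii)). [cite: Lange2023AbelianVarietiesComplex, §2.7.1 Lemma 2.7.1 (ii)] [cite: IribarLopez2024NoetherLefschetzCycles, §2.2 Lemma 10] -/
theorem IsAntisymplectic.injective [DecidableEq ι₁] [DecidableEq ι₂]
    {G₁ : Matrix ι₁ ι₁ ℤ} {G₂ : Matrix ι₂ ι₂ ℤ} {p : kerPhiH Φ₁ G₁ →+ kerPhiH Φ₂ G₂}
    (hp : IsAntisymplectic ω₁ ω₂ p) (hG₁ : G₁.map (Int.cast : ℤ → ℝ) = latticeGram Φ₁ ω₁) (hdet : G₁.det ≠ 0)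
    (hG₂ : G₂.map (Int.cast : ℤ → ℝ) = latticeGram Φ₂ ω₂) : Injective p := by
  intro s t hst
  rw [← sub_eq_zero]
  apply Subtype.ext
  refine eq_zero_of_forall_weilPairing_eq_one Φ₁ ω₁ hG₁ hdet (s - t).2 fun u hu ↦ ?_
  have h := hp (s - t) ⟨u, hu⟩
  rw [map_sub, hst, sub_self, AddSubgroup.coe_zero, weilPairing_zero_left Φ₂ ω₂ hG₂ (p ⟨u, hu⟩).2] at h
  exact inv_eq_one.1 h.symm

end Antisymplectic

/-! ### §4 Debarre's torus `(Y × Z)/graph(p)`: `graph(p)` is maximal isotropic, `L₁ ⊠ L₂` descends to a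
principal polarisation -/

section Principal

variable {Φ₁ Φ₂ ω₁ ω₂} [DecidableEq ι₁] [DecidableEq ι₂] {G₁ : Matrix ι₁ ι₁ ℤ} {G₂ : Matrix ι₂ ι₂ ℤ}

/-- An isomorphism `K(L₁) ≅ K(L₂)` forces `#K(L₁) = #K(L₂)` (`= (d₁⋯d_u)²` for the types `δ`, `δ̃`).
[cite: Auffarth2016NonSimplePPAV, §3 ("`K(L_X) ≃ K(D)` (non-canonically)"; proof of Lemma 3.7 "`|H| = (d₁⋯d_u)²`")] -/
theorem natCard_kerPhiH_eq_of_bijective {p : kerPhiH Φ₁ G₁ →+ kerPhiH Φ₂ G₂} (hp : Bijective p) :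
    Nat.card (kerPhiH Φ₁ G₁) = Nat.card (kerPhiH Φ₂ G₂) :=
  Nat.card_congr (Equiv.ofBijective p hp)

/-- **`(#graph(p))² = #K(L₁ ⊠ L₂)`** for a bijection `p : K(L₁) → K(L₂)` ("`|H| = (d₁⋯d_u)²`" while
`#K(L_X ⊠ L_Y) = (d₁⋯d_u)⁴`). [cite: Auffarth2016NonSimplePPAV, §3, proof of Lemma 3.7] -/
theorem natCard_graphSubgroup_sq {p : kerPhiH Φ₁ G₁ →+ kerPhiH Φ₂ G₂} (hp : Bijective p) :
    Nat.card (graphSubgroup (kerPhiH Φ₁ G₁) (kerPhiH Φ₂ G₂) p) ^ 2 =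
      Nat.card (kerPhiH (prodPeriod Φ₁ Φ₂) (Matrix.fromBlocks G₁ 0 0 G₂)) := by
  rw [natCard_graphSubgroup, natCard_kerPhiH_prodPeriod, ← natCard_kerPhiH_eq_of_bijective hp, sq]

variable (hω₁ : IsRiemannForm Φ₁ ω₁) (hω₂ : IsRiemannForm Φ₂ ω₂)
  (hG₁ : G₁.map (Int.cast : ℤ → ℝ) = latticeGram Φ₁ ω₁) (hG₂ : G₂.map (Int.cast : ℤ → ℝ) = latticeGram Φ₂ ω₂)
  {p : kerPhiH Φ₁ G₁ →+ kerPhiH Φ₂ G₂} (hp : Bijective p) (ha : IsAntisymplectic ω₁ ω₂ p)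

omit [DecidableEq ι₂] in
include hω₁ hG₁ in
/-- For polarised `(Y, ω₁)` the graph of any `p : K(L₁) → K₂` is finite (`K(L₁)` is finite, Prop. 1.4.7).
[cite: Lange2023AbelianVarietiesComplex, §1.4.2 Prop. 1.4.7] [cite: Auffarth2016NonSimplePPAV, §3 ("a finite subgroup `H ≤ X × Y`")] -/
theorem IsRiemannForm.finite_graphSubgroup {K₂ : AddSubgroup (ComplexTorus Φ₂)} (p : kerPhiH Φ₁ G₁ →+ K₂) :
    Finite (graphSubgroup (kerPhiH Φ₁ G₁) K₂ p) :=
  haveI := hω₁.finite_kerPhiH hG₁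
  ComplexTorus.finite_graphSubgroup _ _ p

include hω₁ hω₂ hG₁ hG₂ hp ha in
/-- **`graph(p)` is a MAXIMAL isotropic subgroup of `K(L₁ ⊠ L₂)`** (in the form `graph(p)^⊥ ⊆ graph(p)`) for an
antisymplectic bijection `p : K(L₁) → K(L₂)` of polarised tori: it is isotropic and `(#graph(p))² = #K(L₁ ⊠ L₂)`.
[cite: Auffarth2016NonSimplePPAV, §3, proof of Lemma 3.7 ("`|H| = (d₁⋯d_u)²` … and so `H` is a maximal isotropic subgroup for `L_X ⊠ L_Y`")] [cite: IribarLopez2024NoetherLefschetzCycles, §2.1 ("given a Lagrangian subgroup `H` of `K(θ)`") and §2.2 Lemma 10] -/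
theorem graphSubgroup_maximal_isotropic :
    ∀ t ∈ kerPhiH (prodPeriod Φ₁ Φ₂) (Matrix.fromBlocks G₁ 0 0 G₂),
      (∀ s ∈ graphSubgroup (kerPhiH Φ₁ G₁) (kerPhiH Φ₂ G₂) p,
        weilPairing (prodPeriod Φ₁ Φ₂) (prodForm ω₁ ω₂) s t = 1) →
      t ∈ graphSubgroup (kerPhiH Φ₁ G₁) (kerPhiH Φ₂ G₂) p := by
  haveI := hω₁.finite_graphSubgroup hG₁ p
  exact (sq_natCard_eq_iff_maximal_isotropic (prodPeriod Φ₁ Φ₂) _ (hω₁.prod hω₂)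
    (fromBlocks_map_eq_latticeGram_prod Φ₁ Φ₂ ω₁ ω₂ hG₁ hG₂) (graphSubgroup_le_kerPhiH _ _ p le_rfl le_rfl)
    (forall_weilPairing_graphSubgroup_eq_one_iff.2 ha)).1 (natCard_graphSubgroup_sq hp)

include hω₁ hω₂ hG₁ hG₂ hp ha in
/-- **`graph(p)` is maximal among the isotropic subgroups of `K(L₁ ⊠ L₂)`** (Lange's wording of Cor. 2.7.3 (a)).
[cite: Lange2023AbelianVarietiesComplex, §2.7.1 Cor. 2.7.3 (a)] [cite: Auffarth2016NonSimplePPAV, §3, proof of Lemma 3.7] -/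
theorem graphSubgroup_maximal_isotropic' (U : AddSubgroup (ComplexTorus (prodPeriod Φ₁ Φ₂)))
    (hU : graphSubgroup (kerPhiH Φ₁ G₁) (kerPhiH Φ₂ G₂) p ≤ U)
    (hUK : U ≤ kerPhiH (prodPeriod Φ₁ Φ₂) (Matrix.fromBlocks G₁ 0 0 G₂))
    (hiso : ∀ s ∈ U, ∀ t ∈ U, weilPairing (prodPeriod Φ₁ Φ₂) (prodForm ω₁ ω₂) s t = 1) :
    U = graphSubgroup (kerPhiH Φ₁ G₁) (kerPhiH Φ₂ G₂) p := by
  haveI := hω₁.finite_graphSubgroup hG₁ p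
  exact (forall_isotropic_imp_eq_iff (prodPeriod Φ₁ Φ₂) _ (fromBlocks_map_eq_latticeGram_prod Φ₁ Φ₂ ω₁ ω₂ hG₁ hG₂)
    (graphSubgroup_le_kerPhiH _ _ p le_rfl le_rfl) (forall_weilPairing_graphSubgroup_eq_one_iff.2 ha)).2
    (graphSubgroup_maximal_isotropic hω₁ hω₂ hG₁ hG₂ hp ha) U hU hUK hiso

include hω₁ hω₂ hG₁ hG₂ ha in
/-- **`c₁(L₁ ⊠ L₂) = p₁^*ω₁ + p₂^*ω₂` is a Néron–Severi form of `(Y × Z)/graph(p)`** (it is integral on the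
lattice `π⁻¹(graph(p))`: Prop. 2.7.2 for the isotropic kernel `graph(p)`).
[cite: Lange2023AbelianVarietiesComplex, §2.7.1 Prop. 2.7.2] [cite: Auffarth2016NonSimplePPAV, §3 ("By descent theory for abelian varieties")] -/
theorem isNSForm_quotientBy_graphSubgroup [Finite (graphSubgroup (kerPhiH Φ₁ G₁) (kerPhiH Φ₂ G₂) p)] :
    IsNSForm (quotientByPeriod (prodPeriod Φ₁ Φ₂) (graphSubgroup (kerPhiH Φ₁ G₁) (kerPhiH Φ₂ G₂) p))
      (prodForm ω₁ ω₂) :=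
  (hω₁.prod hω₂).isNSForm.quotientBy (prodPeriod Φ₁ Φ₂) _ (fromBlocks_map_eq_latticeGram_prod Φ₁ Φ₂ ω₁ ω₂ hG₁ hG₂)
    (graphSubgroup_le_kerPhiH _ _ p le_rfl le_rfl) (forall_weilPairing_graphSubgroup_eq_one_iff.2 ha)

include hω₁ hω₂ hG₁ hG₂ ha in
/-- `p₁^*ω₁ + p₂^*ω₂` is a Riemann form (a polarisation) of `(Y × Z)/graph(p)`.
[cite: Lange2023AbelianVarietiesComplex, §2.7.1 Cor. 2.7.3 (a)] [cite: IribarLopez2024NoetherLefschetzCycles, §2.2 Lemma 10] -/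
theorem isRiemannForm_quotientBy_graphSubgroup [Finite (graphSubgroup (kerPhiH Φ₁ G₁) (kerPhiH Φ₂ G₂) p)] :
    IsRiemannForm (quotientByPeriod (prodPeriod Φ₁ Φ₂) (graphSubgroup (kerPhiH Φ₁ G₁) (kerPhiH Φ₂ G₂) p))
      (prodForm ω₁ ω₂) :=
  (hω₁.prod hω₂).quotientBy (prodPeriod Φ₁ Φ₂) _ (isNSForm_quotientBy_graphSubgroup hω₁ hω₂ hG₁ hG₂ ha)

include hω₁ hω₂ hG₁ hG₂ hp ha in
/-- **Iribar López 2024, Lemma 10 (first assertion) / Debarre's construction: `(Y × Z)/graph(p)` is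
PRINCIPALLY polarised.**  For polarised complex tori `(Y, ω₁)`, `(Z, ω₂)` (Riemann forms, integer Gram
matrices `G₁`, `G₂`, `K(L₁) = kerPhiH Φ₁ G₁`, `K(L₂) = kerPhiH Φ₂ G₂`) and an ANTISYMPLECTIC isomorphism
`p : K(L₁) → K(L₂)` of the Weil pairings, the form `c₁(L₁ ⊠ L₂) = p₁^*ω₁ + p₂^*ω₂` is a principal
polarisation of the quotient torus `(Y × Z)/graph(p)` (`quotientByPeriod`, on the same covering space
`E₁ × E₂`; `Ker` of the projection `= graph(p)` by `ker_mapMatrixHom_quotientBy`) — "the abelian variety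
`(Y × Z)/graph(p)` has a canonical principal polarization `θ_p`".  No hypothesis on the types is needed (an
antisymplectic isomorphism exists only if `#K(L₁) = #K(L₂)`).  The instance argument is supplied by
`IsRiemannForm.finite_graphSubgroup`. [cite: IribarLopez2024NoetherLefschetzCycles, §2.2 Lemma 10] [cite: Auffarth2016NonSimplePPAV, §3 ("`(X × Y)/Γ_{g⁻¹εf}` has a unique principal polarization … its pullback to `X × Y` is `L_X ⊠ L_Y`")] [cite: Lange2023AbelianVarietiesComplex, §2.7.1 Cor. 2.7.3 (a)] -/
theorem isPrincipalPolarization_quotientBy_graphSubgroup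
    [Finite (graphSubgroup (kerPhiH Φ₁ G₁) (kerPhiH Φ₂ G₂) p)] :
    IsPrincipalPolarization
      (quotientByPeriod (prodPeriod Φ₁ Φ₂) (graphSubgroup (kerPhiH Φ₁ G₁) (kerPhiH Φ₂ G₂) p))
      (prodForm ω₁ ω₂) :=
  (isPrincipalPolarization_quotientBy_iff (prodPeriod Φ₁ Φ₂) _ (hω₁.prod hω₂)
    (fromBlocks_map_eq_latticeGram_prod Φ₁ Φ₂ ω₁ ω₂ hG₁ hG₂) (graphSubgroup_le_kerPhiH _ _ p le_rfl le_rfl)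
    (forall_weilPairing_graphSubgroup_eq_one_iff.2 ha)).2
    (graphSubgroup_maximal_isotropic hω₁ hω₂ hG₁ hG₂ hp ha)

include hω₁ hω₂ hG₁ hG₂ ha in
/-- `(Y × Z)/graph(p)` with `p₁^*ω₁ + p₂^*ω₂` is an abelian variety (a polarised torus).
[cite: IribarLopez2024NoetherLefschetzCycles, §2.2 Lemma 10] -/
theorem isAbelianVariety_quotientBy_graphSubgroup [Finite (graphSubgroup (kerPhiH Φ₁ G₁) (kerPhiH Φ₂ G₂) p)] :
    IsAbelianVariety
      (quotientByPeriod (prodPeriod Φ₁ Φ₂) (graphSubgroup (kerPhiH Φ₁ G₁) (kerPhiH Φ₂ G₂) p)) :=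
  ⟨prodForm ω₁ ω₂, isRiemannForm_quotientBy_graphSubgroup hω₁ hω₂ hG₁ hG₂ ha⟩

include hω₁ hω₂ hG₁ hG₂ hp ha in
/-- **"A canonical principal polarization `θ_p`": `L₁ ⊠ L₂ = π^* M` with `M` principal** — Cor. 2.7.3 (a)
for the maximal isotropic subgroup `graph(p)`: for every semicharacter `χ` of `L = L(p₁^*H₁ + p₂^*H₂, χ)` on
`Y × Z`, the projection `π : Y × Z → (Y × Z)/graph(p)` is holomorphic, `χ` extends to a semicharacter `χ₁`
of the quotient, `p₁^*ω₁ + p₂^*ω₂` is a PRINCIPAL polarisation there, and `π^* L(H, χ₁) ⊗ L(−H, χ⁻¹)` is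
holomorphically trivial ("by descent theory … a unique principal polarization `L` such that its pullback to
`X × Y` is `L_X ⊠ L_Y`"). [cite: Auffarth2016NonSimplePPAV, §3] [cite: Lange2023AbelianVarietiesComplex, §2.7.1 Cor. 2.7.3 (a)] [cite: IribarLopez2024NoetherLefschetzCycles, §2.2 Lemma 10] -/
theorem exists_isPrincipalPolarization_isTrivialOn_pullback_quotientBy_graphSubgroup
    [Finite (graphSubgroup (kerPhiH Φ₁ G₁) (kerPhiH Φ₂ G₂) p)] {χ : (ι₁ ⊕ ι₂ → ℤ) → ℂ}
    (hχ : IsSemicharacter (prodPeriod Φ₁ Φ₂) (prodForm ω₁ ω₂) χ) :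
    ∃ (h : MDifferentiable 𝓘(ℂ, E₁ × E₂) 𝓘(ℂ, E₁ × E₂)
        (mapMatrix (prodPeriod Φ₁ Φ₂)
          (quotientByPeriod (prodPeriod Φ₁ Φ₂) (graphSubgroup (kerPhiH Φ₁ G₁) (kerPhiH Φ₂ G₂) p))
          (quotientMatrix (prodPeriod Φ₁ Φ₂) (graphSubgroup (kerPhiH Φ₁ G₁) (kerPhiH Φ₂ G₂) p))))
      (χ₁ : (ι₁ ⊕ ι₂ → ℤ) → ℂ)
      (hη₁ : IsNSForm
        (quotientByPeriod (prodPeriod Φ₁ Φ₂) (graphSubgroup (kerPhiH Φ₁ G₁) (kerPhiH Φ₂ G₂) p))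
        (prodForm ω₁ ω₂))
      (hχ₁ : IsSemicharacter
        (quotientByPeriod (prodPeriod Φ₁ Φ₂) (graphSubgroup (kerPhiH Φ₁ G₁) (kerPhiH Φ₂ G₂) p))
        (prodForm ω₁ ω₂) χ₁),
      IsPrincipalPolarization
          (quotientByPeriod (prodPeriod Φ₁ Φ₂) (graphSubgroup (kerPhiH Φ₁ G₁) (kerPhiH Φ₂ G₂) p))
          (prodForm ω₁ ω₂) ∧
        (∀ n, χ₁ ((quotientMatrix (prodPeriod Φ₁ Φ₂)
          (graphSubgroup (kerPhiH Φ₁ G₁) (kerPhiH Φ₂ G₂) p)).mulVec n) = χ n) ∧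
        (((lineBundleAH hη₁ hχ₁).pullback
            (mapMatrix (prodPeriod Φ₁ Φ₂)
              (quotientByPeriod (prodPeriod Φ₁ Φ₂) (graphSubgroup (kerPhiH Φ₁ G₁) (kerPhiH Φ₂ G₂) p))
              (quotientMatrix (prodPeriod Φ₁ Φ₂) (graphSubgroup (kerPhiH Φ₁ G₁) (kerPhiH Φ₂ G₂) p)))
            h).tensor
          (lineBundleAH (hω₁.prod hω₂).isNSForm.neg hχ.inv)).IsTrivialOn Set.univ :=
  exists_isPrincipalPolarization_isTrivialOn_pullback_quotientBy (prodPeriod Φ₁ Φ₂) _ (hω₁.prod hω₂) hχ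
    (fromBlocks_map_eq_latticeGram_prod Φ₁ Φ₂ ω₁ ω₂ hG₁ hG₂) (graphSubgroup_le_kerPhiH _ _ p le_rfl le_rfl)
    (forall_weilPairing_graphSubgroup_eq_one_iff.2 ha)
    (graphSubgroup_maximal_isotropic' hω₁ hω₂ hG₁ hG₂ hp ha)

/-! #### The projection `π : Y × Z → (Y × Z)/graph(p)`: kernel `graph(p)`, degree `#K(L₁)`, injective on
the factors -/

variable {K₁ : AddSubgroup (ComplexTorus Φ₁)} {K₂ : AddSubgroup (ComplexTorus Φ₂)} (q : K₁ →+ K₂)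
  [Finite (graphSubgroup K₁ K₂ q)]

/-- **`deg π = #graph(p) = #K₁`** for `π : Y × Z → (Y × Z)/graph(p)` (`Ker π = graph(p)`,
`ker_mapMatrixHom_quotientBy`). [cite: Lange2023AbelianVarietiesComplex, §1.1.2 Prop. 1.1.13] [cite: IribarLopez2024NoetherLefschetzCycles, §2.2 Lemma 10] -/
theorem natCard_ker_mapMatrixHom_quotientBy_graphSubgroup :
    Nat.card (mapMatrixHom (prodPeriod Φ₁ Φ₂) (quotientByPeriod (prodPeriod Φ₁ Φ₂) (graphSubgroup K₁ K₂ q))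
      (quotientMatrix (prodPeriod Φ₁ Φ₂) (graphSubgroup K₁ K₂ q))).ker = Nat.card K₁ := by
  rw [natCard_ker_mapMatrixHom_quotientBy, natCard_graphSubgroup]

/-- **`π|_{0 × Z}` is injective**: a point of `0 × Z` killed by `π : Y × Z → (Y × Z)/graph(p)` is `0`
(`Ker π ∩ (0 × Z) = graph(p) ∩ (0 × Z) = 0`). [cite: Auffarth2016NonSimplePPAV, §3, proof of Lemma 3.7 ("`H ∩ {0} × Y = {(0,0)}`")] [cite: IribarLopez2024NoetherLefschetzCycles, §2.2 Lemma 10 ("contains `(Z, θ_Z)`")] -/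
theorem eq_zero_of_mem_subtorus_sndSubspace_of_mapMatrix_quotientBy_eq_zero
    {t : ComplexTorus (prodPeriod Φ₁ Φ₂)}
    (ht : t ∈ subtorus (prodPeriod Φ₁ Φ₂) (sndSubspace : Submodule ℝ (ι₁ ⊕ ι₂ → ℝ)))
    (h0 : mapMatrix (prodPeriod Φ₁ Φ₂) (quotientByPeriod (prodPeriod Φ₁ Φ₂) (graphSubgroup K₁ K₂ q))
      (quotientMatrix (prodPeriod Φ₁ Φ₂) (graphSubgroup K₁ K₂ q)) t = 0) : t = 0 := by
  have hker : t ∈ (mapMatrixHom (prodPeriod Φ₁ Φ₂)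
      (quotientByPeriod (prodPeriod Φ₁ Φ₂) (graphSubgroup K₁ K₂ q))
      (quotientMatrix (prodPeriod Φ₁ Φ₂) (graphSubgroup K₁ K₂ q))).ker := h0
  rw [ker_mapMatrixHom_quotientBy] at hker
  exact eq_zero_of_mem_graphSubgroup_of_fst_eq_zero K₁ K₂ q hker
    ((mem_subtorus_sndSubspace_iff Φ₁ Φ₂ t).1 ht)

/-- **`π|_{Y × 0}` is injective** (for `p` injective): `Ker π ∩ (Y × 0) = graph(p) ∩ (Y × 0) = 0`.
[cite: Auffarth2016NonSimplePPAV, §3, proof of Lemma 3.7 ("`H ∩ X × {0} = {(0,0)}`")] [cite: IribarLopez2024NoetherLefschetzCycles, §2.2 Lemma 10 ("contains `(Y, θ_Y)`")] -/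
theorem eq_zero_of_mem_subtorus_fstSubspace_of_mapMatrix_quotientBy_eq_zero (hq : Injective q)
    {t : ComplexTorus (prodPeriod Φ₁ Φ₂)}
    (ht : t ∈ subtorus (prodPeriod Φ₁ Φ₂) (fstSubspace : Submodule ℝ (ι₁ ⊕ ι₂ → ℝ)))
    (h0 : mapMatrix (prodPeriod Φ₁ Φ₂) (quotientByPeriod (prodPeriod Φ₁ Φ₂) (graphSubgroup K₁ K₂ q))
      (quotientMatrix (prodPeriod Φ₁ Φ₂) (graphSubgroup K₁ K₂ q)) t = 0) : t = 0 := by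
  have hker : t ∈ (mapMatrixHom (prodPeriod Φ₁ Φ₂)
      (quotientByPeriod (prodPeriod Φ₁ Φ₂) (graphSubgroup K₁ K₂ q))
      (quotientMatrix (prodPeriod Φ₁ Φ₂) (graphSubgroup K₁ K₂ q))).ker := h0
  rw [ker_mapMatrixHom_quotientBy] at hker
  exact eq_zero_of_mem_graphSubgroup_of_snd_eq_zero K₁ K₂ q hq hker
    ((mem_subtorus_fstSubspace_iff Φ₁ Φ₂ t).1 ht)

end Principal



/-! ### §5 Validation: the case `K(L₁) = 0` (both factors principally polarised) -/

section Validation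

variable {Φ₁ Φ₂ ω₁ ω₂} [DecidableEq ι₁] [DecidableEq ι₂] {G₁ : Matrix ι₁ ι₁ ℤ} {G₂ : Matrix ι₂ ι₂ ℤ}

omit [DecidableEq ι₂] in
/-- **The case `u = 0` / principal factors**: if `(Y, ω₁)` is principally polarised then `K(L₁) = 0`, the graph
of any `p : K(L₁) → K₂` is trivial and Debarre's quotient is `Y × Z` itself (whose product polarisation is
principal iff both factors are, `IsPrincipalPolarization.prod`). [cite: IribarLopez2024NoetherLefschetzCycles, §2.2 (complementary type `δ̃ = (1, …, 1)` for `u = 0`) and Lemma 10] [cite: Lange2023AbelianVarietiesComplex, §2.4.4 Cor. 2.4.24] -/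
theorem IsPrincipalPolarization.graphSubgroup_eq_bot (h₁ : IsPrincipalPolarization Φ₁ ω₁)
    (hG₁ : G₁.map (Int.cast : ℤ → ℝ) = latticeGram Φ₁ ω₁) {K₂ : AddSubgroup (ComplexTorus Φ₂)}
    (p : kerPhiH Φ₁ G₁ →+ K₂) : graphSubgroup (kerPhiH Φ₁ G₁) K₂ p = ⊥ :=
  graphSubgroup_eq_bot_of_eq_bot _ _ p
    ((h₁.isRiemannForm.isPrincipalPolarization_iff_kerPhiH_eq_bot hG₁).1 h₁)

/-- Conversely, if Debarre's data exist with `K(L₁) = 0` — i.e. some bijection `K(L₁) → K(L₂)` — then `Z` is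
principally polarised as well (`#K(L₂) = #K(L₁) = 1`). [cite: IribarLopez2024NoetherLefschetzCycles, §2.2 Lemma 10 (the case `u = 0`)] [cite: Lange2023AbelianVarietiesComplex, §1.4.2 Prop. 1.4.7] -/
theorem IsPrincipalPolarization.of_bijective_kerPhiH (h₁ : IsPrincipalPolarization Φ₁ ω₁)
    (hG₁ : G₁.map (Int.cast : ℤ → ℝ) = latticeGram Φ₁ ω₁) (hω₂ : IsRiemannForm Φ₂ ω₂)
    (hG₂ : G₂.map (Int.cast : ℤ → ℝ) = latticeGram Φ₂ ω₂) {p : kerPhiH Φ₁ G₁ →+ kerPhiH Φ₂ G₂}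
    (hp : Bijective p) : IsPrincipalPolarization Φ₂ ω₂ := by
  rw [hω₂.isPrincipalPolarization_iff_kerPhiH_eq_bot hG₂, AddSubgroup.eq_bot_iff_card,
    ← natCard_kerPhiH_eq_of_bijective hp, ← AddSubgroup.eq_bot_iff_card]
  exact (h₁.isRiemannForm.isPrincipalPolarization_iff_kerPhiH_eq_bot hG₁).1 h₁

end Validation

end ComplexTorus

end Literature.Geometry.Kaehler

end
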